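import Mathlib
import HarnessLib
import HarnessLib.Audit
import Summits.NavierStokesRegularity.Statement
import Literature.Analysis.FluidPDE.ClassicalSolution
import Literature.Analysis.FluidPDE.LerayHopf
import Literature.Analysis.FluidPDE.NSWave0
import Literature.Analysis.FluidPDE.LocalTypeI
import Literature.Analysis.FluidPDE.VectorCalculus
import Literature.Analysis.FluidPDE.Vorticity
import Literature.Analysis.FluidPDE.NSBoundedMildOseen
import Literature.Analysis.UnboundedOperators.HeatKernel
import Literature.Analysis.FluidPDE.SereginSverak2002PressureLowerBound
import Literature.Analysis.FluidPDE.SelfSimilar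
import Summits.NavierStokesRegularity.NavierStokesRegularity.Theses.ThreadingFlux
import HarnessLib.Audit.Status.Attr

/-!
Route: UnthreadedDoor

# Route UnthreadedDoor — Unthreaded door — a Type-I singularity must thread a sphere with vorticity;
else the poloidal Liouville kernel decides it

It suffices to show X = the UNTHREADED (RADIAL-VORTICITY) DOOR `UnthreadedDoor.Target` (door family
N0, rung «N0-LocalTubeDoorUnthreaded», mint requested from director-ns 2026-08-28T09:42Z; an
INSTRUMENT criterion, not Clay): a classical Leray–Hopf solution that is locally Type I at (x₀,T)
and whose scale-invariant radial vorticity moment ⟪(T−t)·curl u(t)(x₀+√(T−t)y), y⟫ fades in mean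
square on every similarity ball B_R as t→T⁻ is backward bounded at (x₀,T). Assume the opposite and
build the singularity: the zoom limit is a Type-I ancient Oseen-mild profile whose vorticity is
TANGENT TO EVERY SPHERE about the apex (purely poloidal velocity, toroidal vorticity, every vortex
line a closed loop on a sphere); after a time shift it lies in the bounded duality-form class of the
EXISTING open kernel `ThreadingFlux.PoloidalLiouville` (stmt-NavierStokesRegularity-1222, wanted
here BY NAME — the first route that makes it load-bearing for a leaf), which makes every slice
spatially constant; the Oseen formula freezes the constant and Type-I decay kills it, so the profile
is 0 and cannot be singular. The door is strictly WIDER than the proved implosion door (tangential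
velocity ⇒ zero radial vorticity, tree `implosionDoor_passiveRadialVorticity_proof`) and than
axisymmetric-no-swirl data about any axis through x₀. No summit (Clay A–D) is proved by this line;
it bears on rung N0 (door family) and on ThreadingFlux crux #2 only.
Lean: `Summit.NavierStokesRegularity.NavierStokesRegularity.Theses.UnthreadedDoor.Target`

## Assembly
Pure logic (kernel-checked in Sketch2.lean / glue.lean, no sorry): by contradiction, UnthreadedZoom
gives the Type-I Oseen-mild unthreaded singular profile v; for each t<0 shift by δ = −t/2,
ShiftedPoloidalClass puts the shifted field in the kernel's class, PoloidalLiouville makes its slice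
at t/2 — i.e. v(t,·) — constant; ConstantSliceExtinction says a profile with constant slices is not
backward singular — contradiction. The deciding theorem is `closes (hZ : UnthreadedZoom) (hS :
ShiftedPoloidalClass) (hP : PoloidalLiouville) (hE : ConstantSliceExtinction) : Target`; the
Assembly item records the same chain BY NAME (closed by `fun hZ hS hP hE => closes hZ hS hP hE`).

CLOSES_TARGET: closes rung N0-LocalTubeDoorUnthreaded (DOOR) of NavierStokesRegularity: Summit.NavierStokesRegularity.NavierStokesRegularity.Theses.UnthreadedDoor.Target (D-0061; not the summit Statement) — the deciding theorem of this route concludes that registered leaf instead of the Statement decl `NavierStokesRegularity` (class rung: servable and labelled, never counted as concluding the summit Statement).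

Rationale: WHY THIS LINE. Mechanism offered for the kernel (the line skeleton on PoloidalLiouville): the
ANTI-DYNAMO TRANSPLANT with the explicit dictionary magnetic field B ↦ vorticity ω, diffusivity η ↦
ν, conducting ball ↦ ℝ³ with Type-I decay, kinematic flow ↦ the Biot–Savart flow of ω itself.
Dotting the vorticity equation with y gives the exact identity (∂ₛ + v·∇ − Δ)⟪ω,y⟫ = ω·∇⟪v,y⟫ (the
tangential case, source ≡ 0, is the proved tree theorem `hasDerivAt_chi`, ImplosionDoor K1); so an
unthreaded profile satisfies the first integral ω·∇⟪v,y⟫ ≡ 0 — the radial momentum m = ⟪v,y⟫ is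
constant on every closed vortex loop, exactly the constraint under which Kaiser's toroidal-field
theorem (doi:10.1007/s00220-009-0866-5; Kaiser–Schmitt–Busse doi:10.1080/03091929408203677) shows a
purely toroidal FIELD cannot be maintained by ANY flow. In Clebsch form ω = ∇T × y with toroidal
potential T, the induction term is ∇×(v×ω) = ∇(G − v·∇T) × y with G a function of (T,|y|,s) alone,
so T obeys a scalar drift–diffusion equation whose extra terms act level-set-wise — the
symmetry-free replacement of the no-swirl scalar η = ω_θ/r that PoloidalLiouville's own docstring
asks for (KNSS2009 Thm 5.2 is the axisymmetric case, in tree as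
`knss_axisymmetric_no_swirl'_holds`). Imported from kinematic dynamo theory
(Cowling/Bullard–Gellman/Kaiser anti-dynamo theorems, arXiv:1903.07829 §2.3.2) and from parabolic
symmetrization (Bandle 1976, Mossino–Rakotoson 1986, via doi:10.1007/bfb0072686); what no listed
route does: ThreadingFlux (nearest) binds only the time-T trace of u globally and names
Helmholtz/Ertel only, ImplosionDoor needs tangential VELOCITY, the half-space/poloidal doors need a
SIGNED or vanishing vorticity COMPONENT along a fixed direction — none uses sphere-tangency of ω,
the loop first integral, or the anti-dynamo dictionary; the negatives index (1376, 4055,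
PerpetualPump, AdiabaticEddy, Blowup) is untouched.

RANKED CRUXES. #0 Target (target) — The unthreaded door: ν>0, T>0, u classical NS on [0,T)×ℝ³ with
pressure p, Leray–Hopf from rapidly decaying data, locally Type I at (x₀,T) on a parabolic window
(‖u(t,x)‖√(ν(T−t)) ≤ M), and for every R>0 the mean square over B_R of the scale-invariant radial
vorticity moment ⟪(T−t)·curl u(t)(x₀+√(T−t)y), y⟫ tends to 0 as t→T⁻ ⇒ u is backward bounded at
(x₀,T). (why it might fail: a genuinely three-dimensional Type-I profile with vorticity tangent to
all spheres about the apex (a non-axisymmetric «unthreaded» ancient solution) would pass the window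
and be singular — exactly the open content of PoloidalLiouville.) [SereginSverak2009,
arXiv:0709.3599, KNSS2009]
#2 PoloidalLiouville (crux) — SHARED VERBATIM with route ThreadingFlux
(stmt-NavierStokesRegularity-1222): a bounded ancient mild (duality-form) solution of NS (ν=1) on
(−∞,0)×ℝ³ with measurable slices, jointly smooth, whose vorticity is tangent to the spheres about
one fixed centre x₀ at all times, is spatially constant on every slice. The research core; this
route supplies the zoom that feeds it and a line skeleton (anti-dynamo first integral + Kaiser-type
vanishing of the toroidal vorticity potential). [deps: UnthreadedZoom, ShiftedPoloidalClass]
[difficulty: XL] (why it might fail: a non-axisymmetric bounded ancient purely poloidal flow (e.g.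
with only discrete symmetry; single-degree toroidal potentials T=g(r)Y_l satisfy the loop constraint
instantaneously for every l ≥ 2) may exist; only the axisymmetric case (KNSS Thm 5.2) is known.)
[KNSS2009, arXiv:0709.3599, SereginSverak2009, doi:10.1007/s00220-009-0866-5,
doi:10.1080/03091929408203677]
#3 ConstantSliceExtinction (crux) — A Type-I ancient Oseen-mild divergence-free profile on (−∞,0)×ℝ³
(|v(s,y)| ≤ C/√(−s), continuous, v(t) = e^((t−s)Δ)v(s) − B_s(v,v)(t)) all of whose slices are
spatially constant is not backward singular at (0,0): the heat extension of a constant is the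
constant and the Oseen–Duhamel term of spatially constant slices vanishes (the kernel is a spatial
DERIVATIVE), so v(t) = v(s) for all s<t<0, and |v| ≤ C/√(−s) for every s forces v ≡ 0. [difficulty:
M] (why it might fail: needs the zero-mean property ∫∇𝒪(t−τ,x−z)dz = 0 of the Oseen tensor inside
the tree definition `oseenDuhamel` for merely bounded (non-integrable) constant slices — if the tree
kernel is only conditionally integrable the Fubini step must be done by truncation.)
[LemarieRieusset2016, KNSS2009, arXiv:0709.3599]
#9 ShiftedPoloidalClass (support) — Packaging for the shared kernel: a Type-I ancient Oseen-mild
divergence-free profile with ⟪curl v(s)(y), y⟫ = 0 for all s<0, y, shifted in time by any δ>0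
(w(t,x) = v(t−δ,x)), is a bounded ancient mild solution in duality form (tree
`isBoundedAncientMildSolution_of_oseen`, bound C/√δ), has (strongly) measurable and jointly C^∞
slices on (−∞,0)×ℝ³ (tree `exists_classical_of_class` ⇒ classical ⇒ smooth), and its vorticity is
tangent to the spheres about x₀ = 0. [difficulty: provable-now] [LemarieRieusset2016, KNSS2009,
arXiv:0709.3599]
#9 UnthreadedZoom (support) — Zoom with the radial-vorticity window: under the leaf's frame
hypotheses, the door hypothesis and ¬ backward bounded at (x₀,T), rescaling about x₀ along λ_j→0
(clone of the CLOSED HalfSpaceZoom stmt-25312 / ImplosionZoom stmt-25308) yields a Type-I-in-time,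
continuous, Oseen-mild, divergence-free profile v on (−∞,0)×ℝ³, backward singular at (0,0), with
⟪curl v(s)(y), y⟫ = 0 for all s<0 and y (the faded scale-invariant moment passes to the limit by
locally uniform convergence of the rescaled vorticities + Fatou, then continuity of the slice).
[difficulty: M] [SereginSverak2009, arXiv:0709.3599, arXiv:1811.00502]

TWO-LAYER PLAN. PoloidalLiouville ⇐ (RadialMomentumFirstIntegral: in the smooth class, ⟪curl v, y⟫ ≡
0 ⇒ ⟪curl v, ∇⟪v,y⟫⟫ ≡ 0 — the y-component of the vorticity equation, provable now from the tree
χ-transport calculus) → (ToroidalVorticityExtinction: bounded ancient mild + vorticity tangent to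
spheres + the first integral ⇒ curl v ≡ 0 — the Kaiser-type toroidal-field theorem for the
vorticity, research) → (irrotational bounded div-free slices are constant, harmonic Liouville) →
PoloidalLiouville, k = 3, filed only after a prover asks; the birth skeleton carries exactly these
stubs.

KILL CRITERIA. An explicit bounded ancient (steady, time-periodic or self-similar) NS flow with
vorticity tangent to all spheres about a point and non-constant slices refutes PoloidalLiouville and
closes this route AND ThreadingFlux's kernel (refuted:PoloidalLiouville) — it would be the first
genuinely 3-D rigid ancient solution and of independent interest; a Type-I such flow singular at the
apex would moreover be a blow-up profile candidate. A refutation of ConstantSliceExtinction can only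
be a mis-typing of the Oseen class (then restate with the tree's `IsTypeIAncientMild`). If
PoloidalLiouville is proved inside ThreadingFlux first, this route closes for free (shared item).

NOT DECOMPOSED YET. The toroidal/poloidal (Mie) potential representation v = ∇φ + T·y of an
unthreaded slice, the scalar equation for T with its level-set source G(T,|y|,s), the loop-period /
spherical-rearrangement comparison argument, and the single-degree (T = g(r,s)Y_l) exclusion are
layer-2 children of PoloidalLiouville and live in the line skeleton, not as items. The
identification of the zoom's locally uniform limit with the window functional (Fatou on balls) is
internal to UnthreadedZoom.

CHEAPEST FALSIFIER. (1) KINEMATIC: is «vorticity tangent to all spheres about 0» already rigid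
(forcing axisymmetry without swirl)? NO — checked by hand: for every l ≥ 2 and radial profiles g, b
the field v = ∇(b(r)Y_l) + g(r)Y_l·y has toroidal vorticity ∇(gY_l) × y and satisfies even the loop
constraint (m = (rb′ + r²g)Y_l is constant on the loops {Y_l = c} ∩ S_r); so the crux is genuinely
dynamic and the refuter's first run is to evolve such a datum (l = 2, sectoral) under NS
numerically/perturbatively and watch whether ⟪ω,y⟫ is instantly created (expected: yes — then
unthreadedness at ALL times is a strong dynamic constraint, supporting the line) or an unthreaded
non-axisymmetric branch persists (kills PoloidalLiouville's rigidity half). (2) LOOKUP: KNSS 2009 §5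
[arXiv:0709.3599 p.10]: «the validity of Theorem 5.2 in the absence of the no-swirl assumption is
still an open problem» — confirms the crux is open, not refuted. (3) BC7 tautology probes on all
load-bearing items (run: CLEAN, see birth certificate).

NUMBERS. Type-I window constant M (dimensionless); profile bound |v(s,y)| ≤ C/√(−s) with C = C(M)
from the zoom; shifted bound C/√δ; KNSS Thm 5.2/5.3 thresholds: no swirl, or |v| ≤ C/√(x₁²+x₂²)
[arXiv:0709.3599 p.10]. The window functional ∫_(B_R)⟪(T−t)curl u(t)(x₀+√(T−t)y), y⟫² dy is
invariant under the NS scaling u ↦ λu(λ²t, λx) about (x₀,T) (checked: (T−t)curl u scales like λ⁰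
after y-substitution).

DEFINITION REQUESTS. None: every statement is over existing declarations (`IsClassicalNSSolutionOn`,
`IsLerayHopfOn`, `HasRapidSpatialDecay`, `curl`, `IsBackwardBoundedAt`, `HasTypeITimeDecay`,
`heatExtension`, `oseenDuhamel`, `IsDivFree`, `IsBackwardSingularPoint`,
`IsBoundedAncientMildSolution`). Mint needed: rung «N0-LocalTubeDoorUnthreaded» + alt-closer label
LocalTubeDoorUnthreaded → `…Theses.UnthreadedDoor.Target` (asked director-ns 2026-08-28T09:42Z,
precedent req №45/№46); until registration the route is born draft with its own Target (as
ImplosionDoor/HalfSpaceWindowDoor were).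

Novelty: Searches (2026-08-28): rg over the NS Theses for `curl (. .) ., .⟫`/`poloidal`/`no-swirl`/`tangent
to the spheres` (hits: ThreadingFlux 1218/1222 — the kernel we share by name; ImplosionDoor — radial
VELOCITY; CorkscrewDynamo 1365 — sphere-tangent VELOCITY Liouville, proved;
PoloidalWindowDoor/HalfSpaceWindowDoor — a fixed DIRECTION e); lit search --hybrid "poloidal
toroidal decomposition Navier-Stokes Liouville ancient solution vorticity tangent spheres" (6 docs,
textbooks: Majda–Bertozzi, Lemarié-Rieusset 2016, Seregin 2014 — no such statement)
[corpus:book:seregin2014-lecture-notes-regularity-theory-navier-stokes-equations p.113: «Conjecture: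
any mild bounded ancient solution is a constant»; §6.4.3 no-swirl case]; lit read arxiv:0709.3599
--grep Liouville [corpus:paper:arxiv-0709.3599 p.3 «the case of general three-dimensional fields is
completely open», p.10 Thm 5.2 mechanism η = ω_θ/r + weak Harnack in ℝ⁵]; lit search "toroidal
magnetic field theorem antidynamo" --source all (crossref: Kaiser 2009 CMP
doi:10.1007/s00220-009-0866-5 — paywalled, lit want acq-13883; Kaiser–Schmitt–Busse 1994
doi:10.1080/03091929408203677; Schmitt 1997 doi:10.1007/pl00001417; Kaiser 2009 GAFD
doi:10.1080/03091920903366311 = the theorem FAILS for variable conductivity, scope caveat); lit read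
arxiv:1903.07829 [corpus:paper:arxiv-1903.07829 p.12: Cowling, Zel'dovich planar-flow, toroidal-flow
and B(x,y,t) anti-dynamo theorems]; lit galaxy search "anti-dynamo theorem|toroidal velocity
theorem|C  [refs: 10.1007/s00220-009-0866-5, 10.1080/03091929408203677, 10.1007/pl00001417, 10.1080/03091920903366311, 0709.3599, 1903.07829, book:seregin2014-lecture-notes-regularity-theory-navier-stokes-equations, arxiv:0709.3599, paper:arxiv-0709.3599, doi:10.1007/s00220-009-0866-5, doi:10.1080/03091929408203677, doi:10.1007/pl00001417, doi:10.1080/03091920903366311, arxiv:1903.07829, paper:arxiv-1903.07829, boo]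

Barriers (technique_class: blow-up-zoom, vorticity-geometry, liouville, anti-dynamo): - technique_class: blow-up-zoom, vorticity-geometry, liouville, anti-dynamo
- Literature.Barriers.NavierStokesRegularity.AveragedTypeIBlowup: outside its class for the research
crux — PoloidalLiouville and its line use the exact algebra of the vorticity equation (the identity
(∂ₛ+v·∇−Δ)⟪ω,y⟫ = ω·∇⟪v,y⟫ and ∇×(v×(∇T×y)) = ∇(·)×y need ω = curl v and the precise
transport/stretching structure, false for Tao-averaged bilinear forms); the zoom/packaging supports
would survive averaging, which is why they are rank 9.
- Literature.Barriers.NavierStokesRegularity.EnergySupercriticality: evaded by hypothesis — every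
quantity is scale-invariant (Type-I window, (T−t)ω at parabolic scale, bounded ancient class); the
supercritical energy never enters.
- Literature.Barriers.NavierStokesRegularity.NavierStokesInequalitySingularSolution: not in its
class — no step uses the local energy inequality; the kernel's hypotheses are the mild/duality
identity and smoothness (the EQUATION), which Scheffer-type inequality solutions do not satisfy.
- Literature.Barriers.NavierStokesRegularity.VorticityStrainNonlocality: not beaten head-on; the bet
is that sphere-tangency of ω at all times makes the stretching term a LEVEL-SET-LOCAL source for the
toroidal potential (G = G(T,|y|,s)), i.e. the nonlocal strain enters only through a function of the
transported scalar itself, as in the no-swirl case where it disappears into η = ω_θ/r — declared as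
the XL residual content of PoloidalLiouville.
- Literature.Ba

History (route lifecycle, newest last):
- 2026-08-28T10:42:33Z · closes_target -> closes rung N0-LocalTubeDoorUnthreaded (DOOR) of NavierStokesRegularity: Summit.NavierStokesRegularity.NavierStokesRegularity.Theses.UnthreadedDoor.Target (D-0061; not the summit Statement) (planner-ns-idea-6-g5-0)

sub-problem: NavierStokesRegularity · status: open · opened planner-ns-idea-6-g4-0 2026-08-28T10:14:34Z · rev 1 · ledger route-NavierStokesRegularity-UnthreadedDoor
GENERATED by the gate from the ledger (D-0016/17). Provers cite these decls: `theorem foo : Summit.NavierStokesRegularity.NavierStokesRegularity.Theses.UnthreadedDoor.<Decl> := …` in Summits/NavierStokesRegularity/NavierStokesRegularity/Theorems/<Name>.lean.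
-/

namespace Summit.NavierStokesRegularity.NavierStokesRegularity.Theses.UnthreadedDoor

open scoped BigOperators Topology Manifold Classical MeasureTheory ProbabilityTheory Matrix InnerProductSpace ComplexConjugate ContinuousMap
open Filter Set Function TopologicalSpace MeasureTheory

attribute [summit_statement] _root_.NavierStokesRegularity
-- H21.Audit: the closer leaf Summit.NavierStokesRegularity.NavierStokesRegularity.Theses.UnthreadedDoor.Target is an item decl of this route file — tagged summit_statement below, after its declaration

open Literature.NS

/-- item stmt-NavierStokesRegularity-27408 · target · rank 0 · open · by planner
why it might fail: a genuinely three-dimensional Type-I profile with vorticity tangent to all spheres about the apex (a non-axisymmetric «unthreaded» ancient solution) would pass the window and be singular — exactly the open content of PoloidalLiouville.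
sources: SereginSverak2009, arXiv:0709.3599, KNSS2009
[target] The unthreaded door: ν>0, T>0, u classical NS on [0,T)×ℝ³ with pressure p, Leray–Hopf from
rapidly decaying data, locally Type I at (x₀,T) on a parabolic window (‖u(t,x)‖√(ν(T−t)) ≤ M), and
for every R>0 the mean square over B_R of the scale-invariant radial vorticity moment ⟪(T−t)·curl
u(t)(x₀+√(T−t)y), y⟫ tends to 0 as t→T⁻ ⇒ u is backward bounded at (x₀,T). -/
@[route_item "route-NavierStokesRegularity-UnthreadedDoor"]
def Target : Prop :=
  ∀ (ν T : ℝ), 0 < ν → 0 < T → ∀ (u : ℝ → EuclideanSpace ℝ (Fin 3) → EuclideanSpace ℝ (Fin 3)) (p : ℝ → EuclideanSpace ℝ (Fin 3) → ℝ), Literature.Analysis.FluidPDE.IsClassicalNSSolutionOn (Set.Ico 0 T) ν 0 u p → Literature.Analysis.FluidPDE.IsLerayHopfOn T ν 0 (u 0) u → Literature.Analysis.FluidPDE.HasRapidSpatialDecay (u 0) → ∀ (x₀ : EuclideanSpace ℝ (Fin 3)) (ρ M : ℝ), 0 < ρ → (∀ t ∈ Set.Ico 0 T, T - ρ ^ 2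 < t → ∀ x ∈ Metric.ball x₀ ρ, ‖u t x‖ * Real.sqrt (ν * (T - t)) ≤ M) → (∀ R : ℝ, 0 < R → Filter.Tendsto (fun t => ∫⁻ y in Metric.ball (0 : EuclideanSpace ℝ (Fin 3)) R, ENNReal.ofReal ((⟪(T - t) • Literature.Analysis.FluidPDE.curl (u t) (x₀ + Real.sqrt (T - t) • y), y⟫_ℝ) ^ 2)) (nhdsWithin T (Set.Iio T)) (nhds 0)) → Literature.Analysis.FluidPDE.IsBackwardBoundedAt u T x₀

/-- item stmt-NavierStokesRegularity-1222 · crux · rank 2 · open · by planner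
why it might fail: a non-axisymmetric bounded ancient purely poloidal flow (e.g. with only discrete symmetry; single-degree toroidal potentials T=g(r)Y_l satisfy the loop constraint instantaneously for every l ≥ 2) may exist; only the axisymmetric case (KNSS Thm 5.2) is known.
sources: KNSS2009, arXiv:0709.3599, SereginSverak2009, doi:10.1007/s00220-009-0866-5, doi:10.1080/03091929408203677
[support] POLOIDAL (SYMMETRY-FREE NO-SWIRL) LIOUVILLE THEOREM — the Liouville-class kernel of
UnthreadedNoBlowup and the cheapest place to test the slogan: a bounded ancient mild solution of NS
(ν=1) on ℝ³×(−∞,0) with measurable slices, smooth on (−∞,0)×ℝ³, whose vorticity is TANGENT TO THE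
SPHERES about one fixed centre x₀ at all times (⟨x−x₀, curl v(t)(x)⟩ = 0: v(t) is purely poloidal
w.r.t. x₀ in the Mie/poloidal–toroidal decomposition, x·curl v = −Λ_{S²}(toroidal potential)) is
spatially constant on every slice (conclusion slice-wise and pointwise, as for
LiouvilleConjectureNS: the duality-form class contains the drifts v = b(t)). CONTAINS A PROVED CONE
FACT: axisymmetric no-swirl ⇔ axisymmetric purely poloidal (ω = ω_θ e_θ ⊥ x − x₀ for x₀ on the
axis), and knss_axisymmetric_no_swirl'_holds (KNSS2009 Thm 5.2, proved in
Literature/Analysis/FluidPDE/KNSSAxisymmetricNoSwirlHolds.lean) is exactly this statement under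
IsAxisymmetric ∧ HasNoSwirl. Two ways it can close: RIGIDITY (all-time poloidality about x₀ forces
axisymmetry without swirl about an axis through x₀ — then cite the proved fact), or a symmetry-free
maximum-principle scalar replacing η = ω_θ/r (Ertel potential vorticit -/
@[route_item "route-NavierStokesRegularity-UnthreadedDoor", crux]
def PoloidalLiouville : Prop :=
  ∀ v : ℝ → EuclideanSpace ℝ (Fin 3) → EuclideanSpace ℝ (Fin 3), Literature.Analysis.FluidPDE.IsBoundedAncientMildSolution 1 v → (∀ t < 0, AEStronglyMeasurable (v t) volume) → ContDiffOn ℝ (⊤ : ℕ∞) (Function.uncurry v) (Set.Iio 0 ×ˢ Set.univ) → (∃ x₀ : EuclideanSpace ℝ (Fin 3), ∀ t < 0, ∀ x, inner ℝ (x - x₀) (Literature.Analysis.FluidPDE.curl (v t) x) = 0) → ∀ t < 0, ∃ b : EuclideanSpace ℝ (Fin 3), ∀ x, v t x = b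

/-- item stmt-NavierStokesRegularity-27409 · crux · rank 3 · closed · proved by Summit.NavierStokesRegularity.NavierStokesRegularity.Theorems.unthreadedDoor_constantSliceExtinction_proof (prover) · by planner
why it might fail: needs the zero-mean property ∫∇𝒪(t−τ,x−z)dz = 0 of the Oseen tensor inside the tree definition `oseenDuhamel` for merely bounded (non-integrable) constant slices — if the tree kernel is only conditionally integrable the Fubini step must be done by truncation.
sources: LemarieRieusset2016, KNSS2009, arXiv:0709.3599
[crux] A Type-I ancient Oseen-mild divergence-free profile on (−∞,0)×ℝ³ (|v(s,y)| ≤ C/√(−s),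
continuous, v(t) = e^((t−s)Δ)v(s) − B_s(v,v)(t)) all of whose slices are spatially constant is not
backward singular at (0,0): the heat extension of a constant is the constant and the Oseen–Duhamel
term of spatially constant slices vanishes (the kernel is a spatial DERIVATIVE), so v(t) = v(s) for
all s<t<0, and |v| ≤ C/√(−s) for every s forces v ≡ 0. [difficulty: M] -/
@[route_item "route-NavierStokesRegularity-UnthreadedDoor", crux]
def ConstantSliceExtinction : Prop :=
  ∀ (C : ℝ) (v : ℝ → EuclideanSpace ℝ (Fin 3) → EuclideanSpace ℝ (Fin 3)), Literature.Analysis.FluidPDE.HasTypeITimeDecay C v → ContinuousOn (Function.uncurry v) (Set.Iio (0 : ℝ) ×ˢ Set.univ) → (∀ s t : ℝ, s < t → t < 0 → ∀ x, v t x = Literature.Analysis.UnboundedOperators.heatExtension (v s) (t - s) x - Literature.Analysis.FluidPDE.oseenDuhamel 1 s v v t x) → (∀ t < 0, Literature.Analysis.FluidPDE.VectorCalculus.IsDivFree (v t)) → (∀ t < 0, ∃ b : EuclideanSpace ℝ (Fin 3), ∀ x, v t x = b) → ¬ Literature.Analysis.FluidPDE.IsBackwardSingularPoint v 0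

-- `ConstantSliceExtinction` holds: proved by `Summit.NavierStokesRegularity.NavierStokesRegularity.Theorems.unthreadedDoor_constantSliceExtinction_proof` (its module imports this route file, so no `_holds` link can be stated here).

/-- item stmt-NavierStokesRegularity-27410 · support · rank 9 · closed · proved by Summit.NavierStokesRegularity.NavierStokesRegularity.Theorems.unthreadedDoor_shiftedPoloidalClass_proof (prover) · by planner
sources: LemarieRieusset2016, KNSS2009, arXiv:0709.3599
[support] Packaging for the shared kernel: a Type-I ancient Oseen-mild divergence-free profile with
⟪curl v(s)(y), y⟫ = 0 for all s<0, y, shifted in time by any δ>0 (w(t,x) = v(t−δ,x)), is a bounded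
ancient mild solution in duality form (tree `isBoundedAncientMildSolution_of_oseen`, bound C/√δ),
has (strongly) measurable and jointly C^∞ slices on (−∞,0)×ℝ³ (tree `exists_classical_of_class` ⇒
classical ⇒ smooth), and its vorticity is tangent to the spheres about x₀ = 0. [difficulty:
provable-now] -/
@[route_item "route-NavierStokesRegularity-UnthreadedDoor", crux]
def ShiftedPoloidalClass : Prop :=
  ∀ (C : ℝ) (v : ℝ → EuclideanSpace ℝ (Fin 3) → EuclideanSpace ℝ (Fin 3)), Literature.Analysis.FluidPDE.HasTypeITimeDecay C v → ContinuousOn (Function.uncurry v) (Set.Iio (0 : ℝ) ×ˢ Set.univ) → (∀ s t : ℝ, s < t → t < 0 → ∀ x, v t x = Literature.Analysis.UnboundedOperators.heatExtension (v s) (t - s) x - Literature.Analysis.FluidPDE.oseenDuhamel 1 s v v t x) → (∀ t < 0, Literature.Analysis.FluidPDE.VectorCalculus.IsDivFree (v t)) → (∀ s < 0, ∀ y, ⟪Literature.Analysis.FluidPDE.curl (v s) y, y⟫_ℝ = 0) → ∀ δ : ℝ, 0 < δ → Literature.Analysis.FluidPDE.IsBoundedAncientMildSolution 1 (fun t x =>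 v (t - δ) x) ∧ (∀ t < 0, AEStronglyMeasurable ((fun t x => v (t - δ) x) t) volume) ∧ ContDiffOn ℝ (⊤ : ℕ∞) (Function.uncurry (fun t x => v (t - δ) x)) (Set.Iio 0 ×ˢ Set.univ) ∧ (∀ t < 0, ∀ x, inner ℝ (x - 0) (Literature.Analysis.FluidPDE.curl ((fun t x => v (t - δ) x) t) x) = 0)

-- `ShiftedPoloidalClass` holds: proved by `Summit.NavierStokesRegularity.NavierStokesRegularity.Theorems.unthreadedDoor_shiftedPoloidalClass_proof` (its module imports this route file, so no `_holds` link can be stated here).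

/-- item stmt-NavierStokesRegularity-27411 · support · rank 9 · closed · proved by Summit.NavierStokesRegularity.NavierStokesRegularity.Theorems.unthreadedDoor_unthreadedZoom_proof (prover) · by planner
sources: SereginSverak2009, arXiv:0709.3599, arXiv:1811.00502
[support] Zoom with the radial-vorticity window: under the leaf's frame hypotheses, the door
hypothesis and ¬ backward bounded at (x₀,T), rescaling about x₀ along λ_j→0 (clone of the CLOSED
HalfSpaceZoom stmt-25312 / ImplosionZoom stmt-25308) yields a Type-I-in-time, continuous,
Oseen-mild, divergence-free profile v on (−∞,0)×ℝ³, backward singular at (0,0), with ⟪curl v(s)(y),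
y⟫ = 0 for all s<0 and y (the faded scale-invariant moment passes to the limit by locally uniform
convergence of the rescaled vorticities + Fatou, then continuity of the slice). [difficulty: M] -/
@[route_item "route-NavierStokesRegularity-UnthreadedDoor", crux]
def UnthreadedZoom : Prop :=
  ∀ (ν T : ℝ), 0 < ν → 0 < T → ∀ (u : ℝ → EuclideanSpace ℝ (Fin 3) → EuclideanSpace ℝ (Fin 3)) (p : ℝ → EuclideanSpace ℝ (Fin 3) → ℝ), Literature.Analysis.FluidPDE.IsClassicalNSSolutionOn (Set.Ico 0 T) ν 0 u p → Literature.Analysis.FluidPDE.IsLerayHopfOn T ν 0 (u 0) u → Literature.Analysis.FluidPDE.HasRapidSpatialDecay (u 0) → ∀ (x₀ : EuclideanSpace ℝ (Fin 3)) (ρ M : ℝ), 0 < ρ → (∀ t ∈ Set.Ico 0 T, T - ρ ^ 2 < t → ∀ x ∈ Metric.ball x₀ ρ, ‖u t x‖ * Real.sqrt (ν * (T - t)) ≤ M) → (∀ R : ℝ, 0 < R → Filter.Tendsto (fun t => ∫⁻ y in Metric.ball (0 : EuclideanSpace ℝ (Fin 3)) R, ENNReal.ofReal ((⟪(T - t)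 • Literature.Analysis.FluidPDE.curl (u t) (x₀ + Real.sqrt (T - t) • y), y⟫_ℝ) ^ 2)) (nhdsWithin T (Set.Iio T)) (nhds 0)) → ¬ Literature.Analysis.FluidPDE.IsBackwardBoundedAt u T x₀ → ∃ (C : ℝ) (v : ℝ → EuclideanSpace ℝ (Fin 3) → EuclideanSpace ℝ (Fin 3)), (Literature.Analysis.FluidPDE.HasTypeITimeDecay C v ∧ ContinuousOn (Function.uncurry v) (Set.Iio (0 : ℝ) ×ˢ Set.univ) ∧ (∀ s t : ℝ, s < t → t < 0 → ∀ x, v t x = Literature.Analysis.UnboundedOperators.heatExtension (v s) (t - s) x - Literature.Analysis.FluidPDE.oseenDuhamel 1 s v v t x) ∧ (∀ t < 0, Literature.Analysis.FluidPDE.VectorCalculus.IsDivFree (v t))) ∧ Literature.Analysis.FluidPDE.IsBackwardSingularPoint v 0 ∧ ∀ s < 0, ∀ y, ⟪Literature.Analysis.FluidPDE.curl (v s) y, y⟫_ℝ = 0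

-- `UnthreadedZoom` holds: proved by `Summit.NavierStokesRegularity.NavierStokesRegularity.Theorems.unthreadedDoor_unthreadedZoom_proof` (its module imports this route file, so no `_holds` link can be stated here).

/-- item stmt-NavierStokesRegularity-27412 · assembly · rank 1 · closed · proved by Summit.NavierStokesRegularity.NavierStokesRegularity.Theorems.unthreadedDoor_assembly_proof (prover) · by planner
sources: KNSS2009, SereginSverak2009
[assembly] UnthreadedZoom → ShiftedPoloidalClass → PoloidalLiouville → ConstantSliceExtinction → the
unthreaded door leaf (UnthreadedDoor.Target). -/
@[route_item "route-NavierStokesRegularity-UnthreadedDoor"]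
def Assembly : Prop :=
  UnthreadedZoom → ShiftedPoloidalClass → PoloidalLiouville → ConstantSliceExtinction → Target

-- `Assembly` holds: proved by `Summit.NavierStokesRegularity.NavierStokesRegularity.Theorems.unthreadedDoor_assembly_proof` (its module imports this route file, so no `_holds` link can be stated here).

attribute [summit_statement] _root_.Summit.NavierStokesRegularity.NavierStokesRegularity.Theses.UnthreadedDoor.Target

/-! D-0027 §2.1 — DECIDING THEOREM (planner-authored via `route open/edit --closes-file`; by planner-ns-idea-6-g5-0 2026-08-28T10:42:33Z):
its hypotheses are this route's items and its conclusion the registered leaf `Summit.NavierStokesRegularity.NavierStokesRegularity.Theses.UnthreadedDoor.Target` (rung N0-LocalTubeDoorUnthreaded (DOOR), D-0061) (glue_lint), and it elaborates with this file. -/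

@[closes "route-NavierStokesRegularity-UnthreadedDoor"] theorem closes (hZ : UnthreadedZoom) (hS : ShiftedPoloidalClass) (hP : PoloidalLiouville)
    (hE : ConstantSliceExtinction) : Target := by
  intro ν T hν hT u p hcl hLH hdec x₀ ρ M hρ hwin hfade
  by_contra hbb
  obtain ⟨C, v, ⟨hdecay, hcont, hmild, hdiv⟩, hsing, htor⟩ :=
    hZ ν T hν hT u p hcl hLH hdec x₀ ρ M hρ hwin hfade hbb
  refine hE C v hdecay hcont hmild hdiv ?_ hsing
  intro t ht
  have hδ : 0 < -t / 2 := by linarith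
  obtain ⟨h1, h2, h3, h4⟩ := hS C v hdecay hcont hmild hdiv htor (-t / 2) hδ
  obtain ⟨b, hb⟩ := hP (fun s x => v (s - -t / 2) x) h1 h2 h3 ⟨0, h4⟩ (t / 2) (by linarith)
  refine ⟨b, fun x => ?_⟩
  have hx := hb x
  have ht' : t / 2 - -t / 2 = t := by ring
  simp only [ht'] at hx
  exact hx

end Summit.NavierStokesRegularity.NavierStokesRegularity.Theses.UnthreadedDoor
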